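import Summits.FinalStateConjecture.FinalStateConjecture.Theorems.EIHFluxBalanceInertialRecessionVirialClusterLaw
import Summits.FinalStateConjecture.FinalStateConjecture.Theorems.EIHFluxBalanceInertialRecessionVirialCoercivity
import Summits.FinalStateConjecture.FinalStateConjecture.Theorems.EIHFluxBalanceInertialRecessionVirialIdentity
import Mathlib.MeasureTheory.Integral.IntervalIntegral.FundThmCalculus
import Mathlib.MeasureTheory.Integral.IntervalIntegral.IntegrationByParts

/-!
# Route EIHFluxBalance — crux `InertialRecession`, abstract endgame for general `N`:
# the virial step — the kinematic gain `(a)` of one fine step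

Helper file for the crux `stmt-FinalStateConjecture-10166` (virial route; `InertialRecession_endgame_generalN_virial.md` §4(a),
`InertialRecession_seat0_session8_note.md` §A). Mathlib-only.

* `step_gain_lower_bound` — the `(a)`-part of one virial step: for `a ≤ a′`,
  `Σⱼ ⟨pⱼ(a), (ξⱼ(a′) − ξⱼ(a)) − (X(a′) − X(a))⟩ ≥ (2M_𝒦)⁻¹ ∫_a^{a′} Σⱼₖ MⱼMₖ‖vⱼ − vₖ‖² − (a′ − a)(2ΓM_𝒦 e₀ + 4|𝒦| π₀)`,
  where `e₀` bounds the slaving error `‖ξ̇ⱼ − vⱼ‖` and `π₀` the momentum oscillation `‖pⱼ(s) − pⱼ(a)‖` on the step (FTC for the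
  displacements; pointwise `Σⱼ⟨pⱼ, vⱼ − U⟩ ≥ (2M)⁻¹σ₂` by `virial_coercivity_mean'`).
-/

noncomputable section

open Finset Filter Topology MeasureTheory intervalIntegral Set

namespace Summit.FinalStateConjecture.FinalStateConjecture.Theorems.SublinearIsFree.Virial

open Literature.Geometry.Lorentzian

/-! ### The kinematic gain of one step -/

/-- A weighted average (rest masses) of vectors of norm `≤ e` has norm `≤ e`. [folklore] -/
theorem norm_restMassAvg_le {N : ℕ} (𝒦 : Finset (Fin N)) (M : Fin N → ℝ) (hM : ∀ i, 0 < M i) (h𝒦 : 𝒦.Nonempty)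
    (w : Fin N → E3) {e : ℝ} (hw : ∀ j ∈ 𝒦, ‖w j‖ ≤ e) :
    ‖(∑ k ∈ 𝒦, M k)⁻¹ • ∑ k ∈ 𝒦, M k • w k‖ ≤ e := by
  have hMK : 0 < ∑ k ∈ 𝒦, M k := Finset.sum_pos (fun i _ ↦ hM i) h𝒦
  rw [norm_smul, Real.norm_eq_abs, abs_of_pos (inv_pos.mpr hMK)]
  calc (∑ k ∈ 𝒦, M k)⁻¹ * ‖∑ k ∈ 𝒦, M k • w k‖ ≤ (∑ k ∈ 𝒦, M k)⁻¹ * ∑ k ∈ 𝒦, M k * e := by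
        refine mul_le_mul_of_nonneg_left ((norm_sum_le _ _).trans (Finset.sum_le_sum fun k hk ↦ ?_)) (inv_nonneg.mpr hMK.le)
        rw [norm_smul, Real.norm_eq_abs, abs_of_pos (hM k)]
        exact mul_le_mul_of_nonneg_left (hw k hk) (hM k).le
    _ = e := by rw [← Finset.sum_mul, ← mul_assoc, inv_mul_cancel₀ hMK.ne', one_mul]

/-- **Pointwise lower bound of the virial integrand.** For a nonempty group with masses `Mⱼ > 0`, velocities `‖vⱼ‖ ≤ k < 1`,
"derivatives" `dⱼ` with `‖dⱼ − vⱼ‖ ≤ e₀ ≤ 1`, and "old momenta" `qⱼ` with `‖qⱼ − pⱼ‖ ≤ π₀` where `pⱼ = Mⱼγ(vⱼ)vⱼ`: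
`Σⱼ ⟨qⱼ, dⱼ − X_d⟩ ≥ (2M_𝒦)⁻¹ Σⱼₗ MⱼMₗ‖vⱼ − vₗ‖² − (2ΓM_𝒦e₀ + 4|𝒦|π₀)`, `X_d` the rest-mass average of the `dⱼ`. [folklore] -/
theorem virial_integrand_lower_bound {N : ℕ} (𝒦 : Finset (Fin N)) (M : Fin N → ℝ) (v d q : Fin N → E3) {k e₀ π₀ : ℝ}
    (hM : ∀ i, 0 < M i) (hk : k < 1) (hvk : ∀ i, ‖v i‖ ≤ k) (h𝒦 : 𝒦.Nonempty) (he₁ : e₀ ≤ 1)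
    (he : ∀ j ∈ 𝒦, ‖d j - v j‖ ≤ e₀)
    (hπ : ∀ j ∈ 𝒦, ‖q j - (M j * (√(1 - ‖v j‖ ^ 2))⁻¹) • v j‖ ≤ π₀) :
    (2 * ∑ i ∈ 𝒦, M i)⁻¹ * (∑ j ∈ 𝒦, ∑ l ∈ 𝒦, M j * M l * ‖v j - v l‖ ^ 2) -
        (2 * (√(1 - k ^ 2))⁻¹ * (∑ i ∈ 𝒦, M i) * e₀ + 4 * 𝒦.card * π₀) ≤
      ∑ j ∈ 𝒦, inner ℝ (q j) (d j - (∑ i ∈ 𝒦, M i)⁻¹ • ∑ i ∈ 𝒦, M i • d i) := by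
  obtain ⟨j₀, hj₀⟩ := id h𝒦
  have hk0 : 0 ≤ k := (norm_nonneg _).trans (hvk j₀)
  have hk2 : 0 < 1 - k ^ 2 := by nlinarith
  set MK : ℝ := ∑ i ∈ 𝒦, M i with hMK
  have hMK0 : 0 < MK := Finset.sum_pos (fun i _ ↦ hM i) h𝒦
  set Γ : ℝ := (√(1 - k ^ 2))⁻¹ with hΓ
  have hsk : 0 < √(1 - k ^ 2) := Real.sqrt_pos.mpr hk2
  have hΓ0 : 0 < Γ := inv_pos.mpr hsk
  have hv1 : ∀ i, ‖v i‖ < 1 := fun i ↦ (hvk i).trans_lt hk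
  have hγle : ∀ i, (√(1 - ‖v i‖ ^ 2))⁻¹ ≤ Γ := fun i ↦ by
    rw [hΓ]; exact inv_anti₀ hsk (Real.sqrt_le_sqrt (by nlinarith [norm_nonneg (v i), hvk i]))
  have hγpos : ∀ i, 0 < (√(1 - ‖v i‖ ^ 2))⁻¹ := fun i ↦
    inv_pos.mpr (Real.sqrt_pos.mpr (by nlinarith [norm_nonneg (v i), hv1 i]))
  set p : Fin N → E3 := fun j ↦ (M j * (√(1 - ‖v j‖ ^ 2))⁻¹) • v j with hp
  have hpn : ∀ j, ‖p j‖ ≤ M j * Γ := by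
    intro j
    simp only [hp]
    rw [norm_smul, Real.norm_eq_abs, abs_of_pos (mul_pos (hM j) (hγpos j))]
    calc M j * (√(1 - ‖v j‖ ^ 2))⁻¹ * ‖v j‖ ≤ M j * Γ * 1 :=
          mul_le_mul (mul_le_mul_of_nonneg_left (hγle j) (hM j).le) (hv1 j).le (norm_nonneg _)
            (mul_nonneg (hM j).le hΓ0.le)
      _ = M j * Γ := mul_one _
  set Xd : E3 := MK⁻¹ • ∑ i ∈ 𝒦, M i • d i with hXdd
  set U : E3 := MK⁻¹ • ∑ i ∈ 𝒦, M i • v i with hU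
  have he0 : 0 ≤ e₀ := (norm_nonneg _).trans (he j₀ hj₀)
  have hπ0 : 0 ≤ π₀ := (norm_nonneg _).trans (hπ j₀ hj₀)
  -- split `qⱼ = pⱼ + (qⱼ − pⱼ)` and `d − Xd = (v − U) + ((d − v) − (Xd − U))`
  have hsplit : ∀ j, inner ℝ (q j) (d j - Xd) =
      inner ℝ (p j) (v j - U) + inner ℝ (p j) ((d j - v j) - (Xd - U)) + inner ℝ (q j - p j) (d j - Xd) := by
    intro j
    have h1 : q j = p j + (q j - p j) := by abel
    have h2 : d j - Xd = (v j - U) + ((d j - v j) - (Xd - U)) := by abel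
    conv_lhs => rw [h1, inner_add_left, h2, inner_add_right]
    rw [← h2]
  -- term 1: coercivity
  have hT1 : (2 * MK)⁻¹ * (∑ j ∈ 𝒦, ∑ l ∈ 𝒦, M j * M l * ‖v j - v l‖ ^ 2) ≤ ∑ j ∈ 𝒦, inner ℝ (p j) (v j - U) := by
    have h := virial_coercivity_mean' 𝒦 M v (fun i _ ↦ (hM i).le) (fun i _ ↦ hv1 i) hMK0
    rw [← hMK] at h
    rw [← hU] at h
    have hpU : ∀ j, inner ℝ (p j) (v j - U) = M j * inner ℝ ((√(1 - ‖v j‖ ^ 2))⁻¹ • v j) (v j - U) := fun j ↦ by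
      simp only [hp]
      rw [mul_smul, real_inner_smul_left]
    rw [Finset.sum_congr rfl fun j _ ↦ hpU j]
    exact h
  -- term 2: slaving errors
  have hXdU : ‖Xd - U‖ ≤ e₀ := by
    have : Xd - U = MK⁻¹ • ∑ i ∈ 𝒦, M i • (d i - v i) := by
      simp only [hXdd, hU]; rw [restMassCentre_sub]
    rw [this]
    exact norm_restMassAvg_le 𝒦 M hM h𝒦 (fun i ↦ d i - v i) he
  have hT2 : -(2 * Γ * MK * e₀) ≤ ∑ j ∈ 𝒦, inner ℝ (p j) ((d j - v j) - (Xd - U)) := by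
    have hb : ∀ j ∈ 𝒦, -(M j * Γ * (2 * e₀)) ≤ inner ℝ (p j) ((d j - v j) - (Xd - U)) := by
      intro j hj
      have h1 : |inner ℝ (p j) ((d j - v j) - (Xd - U))| ≤ ‖p j‖ * ‖(d j - v j) - (Xd - U)‖ := abs_real_inner_le_norm _ _
      have h2 : ‖(d j - v j) - (Xd - U)‖ ≤ 2 * e₀ := (norm_sub_le _ _).trans (by linarith [he j hj, hXdU])
      have h3 : ‖p j‖ * ‖(d j - v j) - (Xd - U)‖ ≤ M j * Γ * (2 * e₀) :=
        mul_le_mul (hpn j) h2 (norm_nonneg _) (mul_nonneg (hM j).le hΓ0.le)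
      linarith [neg_abs_le (inner ℝ (p j) ((d j - v j) - (Xd - U)))]
    calc -(2 * Γ * MK * e₀) = ∑ j ∈ 𝒦, -(M j * Γ * (2 * e₀)) := by
          rw [Finset.sum_neg_distrib, hMK, Finset.mul_sum, Finset.sum_mul]
          congr 1
          refine Finset.sum_congr rfl fun j _ ↦ ?_; ring
      _ ≤ _ := Finset.sum_le_sum hb
  -- term 3: momentum oscillation
  have hdn : ∀ j ∈ 𝒦, ‖d j‖ ≤ 2 := fun j hj ↦ by
    calc ‖d j‖ = ‖(d j - v j) + v j‖ := by rw [sub_add_cancel]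
      _ ≤ ‖d j - v j‖ + ‖v j‖ := norm_add_le _ _
      _ ≤ e₀ + k := add_le_add (he j hj) (hvk j)
      _ ≤ 2 := by linarith
  have hXdn : ‖Xd‖ ≤ 2 := norm_restMassAvg_le 𝒦 M hM h𝒦 d hdn
  have hT3 : -(4 * 𝒦.card * π₀) ≤ ∑ j ∈ 𝒦, inner ℝ (q j - p j) (d j - Xd) := by
    have hb : ∀ j ∈ 𝒦, -(4 * π₀) ≤ inner ℝ (q j - p j) (d j - Xd) := by
      intro j hj
      have h1 : |inner ℝ (q j - p j) (d j - Xd)| ≤ ‖q j - p j‖ * ‖d j - Xd‖ := abs_real_inner_le_norm _ _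
      have h2 : ‖d j - Xd‖ ≤ 4 := (norm_sub_le _ _).trans (by linarith [hdn j hj])
      have h3 : ‖q j - p j‖ ≤ π₀ := hπ j hj
      have h4 : ‖q j - p j‖ * ‖d j - Xd‖ ≤ π₀ * 4 := mul_le_mul h3 h2 (norm_nonneg _) hπ0
      linarith [neg_abs_le (inner ℝ (q j - p j) (d j - Xd))]
    calc -(4 * 𝒦.card * π₀) = ∑ _j ∈ 𝒦, -(4 * π₀) := by
          rw [Finset.sum_const, nsmul_eq_mul]; ring
      _ ≤ _ := Finset.sum_le_sum hb
  rw [Finset.sum_congr rfl fun j _ ↦ hsplit j, Finset.sum_add_distrib, Finset.sum_add_distrib]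
  have : 2 * Γ * MK * e₀ = 2 * (√(1 - k ^ 2))⁻¹ * MK * e₀ := by rw [hΓ]
  linarith

/-- **The gain of one virial step (the `(a)`-part).** See the module docstring. [folklore] -/
theorem step_gain_lower_bound {N : ℕ} (𝒦 : Finset (Fin N)) (M : Fin N → ℝ) (ξ v : Fin N → ℝ → E3) {k : ℝ}
    (hM : ∀ i, 0 < M i) (hk : k < 1) (hvk : ∀ i t, ‖v i t‖ ≤ k) (hvc : ∀ i, Continuous (v i))
    (hξ : ∀ i, ContDiff ℝ ((⊤ : ℕ∞) : WithTop ℕ∞) (ξ i)) (h𝒦 : 𝒦.Nonempty)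
    {a a' e₀ π₀ : ℝ} (haa' : a ≤ a') (he₁ : e₀ ≤ 1)
    (he : ∀ s ∈ Icc a a', ∀ j ∈ 𝒦, ‖deriv (ξ j) s - v j s‖ ≤ e₀)
    (hπ : ∀ s ∈ Icc a a', ∀ j ∈ 𝒦,
      ‖(M j * (√(1 - ‖v j a‖ ^ 2))⁻¹) • v j a - (M j * (√(1 - ‖v j s‖ ^ 2))⁻¹) • v j s‖ ≤ π₀) :
    (2 * ∑ i ∈ 𝒦, M i)⁻¹ * (∫ s in a..a', ∑ j ∈ 𝒦, ∑ l ∈ 𝒦, M j * M l * ‖v j s - v l s‖ ^ 2) -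
        (a' - a) * (2 * (√(1 - k ^ 2))⁻¹ * (∑ i ∈ 𝒦, M i) * e₀ + 4 * 𝒦.card * π₀) ≤
      ∑ j ∈ 𝒦, inner ℝ ((M j * (√(1 - ‖v j a‖ ^ 2))⁻¹) • v j a)
        ((ξ j a' - ξ j a) - ((∑ i ∈ 𝒦, M i)⁻¹ • ∑ i ∈ 𝒦, M i • ξ i a' - (∑ i ∈ 𝒦, M i)⁻¹ • ∑ i ∈ 𝒦, M i • ξ i a)) := by
  set MK : ℝ := ∑ i ∈ 𝒦, M i with hMK
  set q : Fin N → E3 := fun j ↦ (M j * (√(1 - ‖v j a‖ ^ 2))⁻¹) • v j a with hq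
  -- derivatives
  have hdiff : ∀ j, Differentiable ℝ (ξ j) := fun j ↦ (hξ j).differentiable (by simp)
  have hcd : ∀ j, Continuous (deriv (ξ j)) := fun j ↦ (hξ j).continuous_deriv (by simp)
  have hFTC : ∀ j, ξ j a' - ξ j a = ∫ s in a..a', deriv (ξ j) s := fun j ↦
    (integral_deriv_eq_sub (fun x _ ↦ hdiff j x) ((hcd j).intervalIntegrable _ _)).symm
  have hcX : Continuous fun s ↦ MK⁻¹ • ∑ i ∈ 𝒦, M i • deriv (ξ i) s :=
    (continuous_const_smul MK⁻¹).comp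
      (continuous_finsetSum 𝒦 fun i _ ↦ (continuous_const_smul (M i)).comp (hcd i))
  -- the centre displacement as an integral
  have hXd : MK⁻¹ • ∑ i ∈ 𝒦, M i • ξ i a' - MK⁻¹ • ∑ i ∈ 𝒦, M i • ξ i a =
      ∫ s in a..a', MK⁻¹ • ∑ i ∈ 𝒦, M i • deriv (ξ i) s := by
    rw [restMassCentre_sub, intervalIntegral.integral_smul, intervalIntegral.integral_finsetSum]
    · congr 1
      refine Finset.sum_congr rfl fun i _ ↦ ?_
      rw [intervalIntegral.integral_smul, hFTC i]
    · intro i _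
      exact ((continuous_const_smul (M i)).comp (hcd i)).intervalIntegrable _ _
  -- the right-hand side as one integral
  have hint_d : ∀ j, IntervalIntegrable (fun s ↦ deriv (ξ j) s - MK⁻¹ • ∑ i ∈ 𝒦, M i • deriv (ξ i) s) volume a a' :=
    fun j ↦ ((hcd j).sub hcX).intervalIntegrable _ _
  have hRHS : ∑ j ∈ 𝒦, inner ℝ (q j) ((ξ j a' - ξ j a) - (MK⁻¹ • ∑ i ∈ 𝒦, M i • ξ i a' - MK⁻¹ • ∑ i ∈ 𝒦, M i • ξ i a)) =
      ∫ s in a..a', ∑ j ∈ 𝒦, inner ℝ (q j) (deriv (ξ j) s - MK⁻¹ • ∑ i ∈ 𝒦, M i • deriv (ξ i) s) := by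
    rw [intervalIntegral.integral_finsetSum]
    · refine Finset.sum_congr rfl fun j _ ↦ ?_
      rw [hFTC j, hXd, ← intervalIntegral.integral_sub ((hcd j).intervalIntegrable _ _) (hcX.intervalIntegrable _ _)]
      rw [← innerSL_apply_apply (𝕜 := ℝ) (q j), ← ContinuousLinearMap.intervalIntegral_comp_comm _ (hint_d j)]
      rfl
    · intro j _
      exact (continuous_const.inner ((hcd j).sub hcX)).intervalIntegrable _ _
  -- pointwise bound, then integrate
  have hpt : ∀ s ∈ Icc a a', (2 * MK)⁻¹ * (∑ j ∈ 𝒦, ∑ l ∈ 𝒦, M j * M l * ‖v j s - v l s‖ ^ 2) -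
      (2 * (√(1 - k ^ 2))⁻¹ * MK * e₀ + 4 * 𝒦.card * π₀) ≤
      ∑ j ∈ 𝒦, inner ℝ (q j) (deriv (ξ j) s - MK⁻¹ • ∑ i ∈ 𝒦, M i • deriv (ξ i) s) := fun s hs ↦
    virial_integrand_lower_bound 𝒦 M (fun j ↦ v j s) (fun j ↦ deriv (ξ j) s) q hM hk (fun i ↦ hvk i s) h𝒦 he₁
      (he s hs) (hπ s hs)
  rw [hRHS]
  have hσc : Continuous fun s ↦ ∑ j ∈ 𝒦, ∑ l ∈ 𝒦, M j * M l * ‖v j s - v l s‖ ^ 2 :=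
    continuous_finsetSum _ fun j _ ↦ continuous_finsetSum _ fun l _ ↦
      (continuous_const.mul (((hvc j).sub (hvc l)).norm.pow 2))
  have hLc : IntervalIntegrable (fun s ↦ (2 * MK)⁻¹ * (∑ j ∈ 𝒦, ∑ l ∈ 𝒦, M j * M l * ‖v j s - v l s‖ ^ 2) -
      (2 * (√(1 - k ^ 2))⁻¹ * MK * e₀ + 4 * 𝒦.card * π₀)) volume a a' :=
    ((hσc.const_smul ((2 * MK)⁻¹ : ℝ)).sub continuous_const).intervalIntegrable _ _
  have hRc : IntervalIntegrable (fun s ↦ ∑ j ∈ 𝒦, inner ℝ (q j) (deriv (ξ j) s - MK⁻¹ • ∑ i ∈ 𝒦, M i • deriv (ξ i) s))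
      volume a a' :=
    (continuous_finsetSum _ fun j _ ↦ continuous_const.inner ((hcd j).sub hcX)).intervalIntegrable _ _
  have hmono := intervalIntegral.integral_mono_on haa' hLc hRc hpt
  have hI1 : IntervalIntegrable (fun s ↦ (2 * MK)⁻¹ * (∑ j ∈ 𝒦, ∑ l ∈ 𝒦, M j * M l * ‖v j s - v l s‖ ^ 2)) volume a a' :=
    (continuous_const.mul hσc).intervalIntegrable _ _
  have hI2 : IntervalIntegrable (fun _ ↦ (2 * (√(1 - k ^ 2))⁻¹ * MK * e₀ + 4 * 𝒦.card * π₀)) volume a a' :=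
    intervalIntegrable_const
  have hsplitI : ∫ s in a..a', ((2 * MK)⁻¹ * (∑ j ∈ 𝒦, ∑ l ∈ 𝒦, M j * M l * ‖v j s - v l s‖ ^ 2) -
      (2 * (√(1 - k ^ 2))⁻¹ * MK * e₀ + 4 * 𝒦.card * π₀)) =
      (2 * MK)⁻¹ * (∫ s in a..a', ∑ j ∈ 𝒦, ∑ l ∈ 𝒦, M j * M l * ‖v j s - v l s‖ ^ 2) -
        (a' - a) * (2 * (√(1 - k ^ 2))⁻¹ * MK * e₀ + 4 * 𝒦.card * π₀) := by
    rw [intervalIntegral.integral_sub hI1 hI2, intervalIntegral.integral_const, intervalIntegral.integral_const_mul,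
      smul_eq_mul]
  rw [hsplitI] at hmono
  exact hmono

/-- Registered one-line form of `step_gain_lower_bound` (the `(a)`-part of one virial step). [folklore] -/
theorem step_gain_lower_bound_of_slaved : open Literature.Geometry.Lorentzian Finset MeasureTheory intervalIntegral Set in ∀ {N : ℕ} (𝒦 : Finset (Fin N)) (M : Fin N → ℝ) (ξ v : Fin N → ℝ → E3) {k : ℝ}, (∀ i, 0 < M i) → k < 1 → (∀ i t, ‖v i t‖ ≤ k) → (∀ i, Continuous (v i)) → (∀ i, ContDiff ℝ ((⊤ : ℕ∞) : WithTop ℕ∞) (ξ i)) → 𝒦.Nonempty → ∀ {a a' e₀ π₀ : ℝ}, a ≤ a' → e₀ ≤ 1 → (∀ s ∈ Icc a a', ∀ j ∈ 𝒦, ‖deriv (ξ j) s - v j s‖ ≤ e₀) → (∀ s ∈ Icc a a', ∀ j ∈ 𝒦, ‖(M j * (√(1 - ‖v j a‖ ^ 2))⁻¹) • v j a - (M j * (√(1 - ‖v j s‖ ^ 2))⁻¹) • v j s‖ ≤ π₀) → (2 * ∑ i ∈ 𝒦, M i)⁻¹ * (∫ s in a..a', ∑ j ∈ 𝒦, ∑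 l ∈ 𝒦, M j * M l * ‖v j s - v l s‖ ^ 2) - (a' - a) * (2 * (√(1 - k ^ 2))⁻¹ * (∑ i ∈ 𝒦, M i) * e₀ + 4 * 𝒦.card * π₀) ≤ ∑ j ∈ 𝒦, inner ℝ ((M j * (√(1 - ‖v j a‖ ^ 2))⁻¹) • v j a) ((ξ j a' - ξ j a) - ((∑ i ∈ 𝒦, M i)⁻¹ • ∑ i ∈ 𝒦, M i • ξ i a' - (∑ i ∈ 𝒦, M i)⁻¹ • ∑ i ∈ 𝒦, M i • ξ i a)) :=
  fun 𝒦 M ξ v _ hM hk hvk hvc hξ h𝒦 _ _ _ _ haa' he₁ he hπ ↦ step_gain_lower_bound 𝒦 M ξ v hM hk hvk hvc hξ h𝒦 haa' he₁ he hπ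

end Summit.FinalStateConjecture.FinalStateConjecture.Theorems.SublinearIsFree.Virial

end
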